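import Literature.AlgebraicGeometry.Frobenioids.ArchimedeanFSM
import Literature.AlgebraicGeometry.Frobenioids.CategoriesFactorizationRevised
import Literature.AlgebraicGeometry.Frobenioids.FSMIMorphisms
import HarnessLib

/-!
# Frobenioids II, Proposition 3.4 (viii): finite factorisation into FSMI-morphisms (condition (a)
# of FSMFF-type) for `F`, assembled from the printed inputs along the tower `F → D`, `F → F₀`
# (abc-iut cell, layer L1, sub-node `FrdII:Prop3.4(viii)/P34-L14` "FFSMFactorsFSMI" of
# `plan/L1/SUBDAG-FrdII-Prop34.md` — the ABSTRACT ASSEMBLY; the per-tower model lemmas it consumes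
# are separate pieces)

Mochizuki, *The geometry of Frobenioids II: poly-Frobenioids*, Kyushu J. Math. **62** (2008)
401–460, §3, Proposition 3.4 (viii) p. 30, proof p. 33 ll. 16–44 of the RIMS preprint = journal
p. 428 ll. 17–41 [cite: MochizukiFrdII2008, Prop 3.4 (viii) p.33]. The printed passage, quoted
VERBATIM from the journal text (the two "def" superscripts over "=" and the line-break hyphen of
"FSMI-morphisms" dropped; nothing else omitted or inserted):

> "Next, let `φ` be an arbitrary FSM-morphism of `F`. Observe that (by [Mzk5, Definition 1.3(iv)(a)]
> applied to the Frobenioid `A₀`) the projection `φ₀` of `φ` to `F₀` admits a factorization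
> `φ₀ = α₀ ∘ β₀`, where `α₀` is a pull-back morphism, and `β₀` is a base-isomorphism. Since the
> projection of `β₀` to `D₀` is an isomorphism, it thus follows that there exists a factorization
> `φ = α ∘ β` in `F`, where `α`, `β` lift `α₀`, `β₀` respectively, and `β_D = Base(β) ∈ Arr(D)` is an
> isomorphism. Since `φ_D = Base(φ) ∈ Arr(D)` is an FSM-morphism (cf. assertion (iii)), it thus
> follows that `α_D = Base(α) = φ_D ∘ β_D⁻¹ ∈ Arr(D)` is an FSM-morphism, hence (by assertion (vii))
> that `α` is an FSM-morphism. Moreover, since `α` is a monomorphism, it follows formally from the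
> fact that `φ` is an FSM-morphism that `β` is an FSM-morphism, hence (by assertion (iv), since `β_D`
> is an isomorphism) that `β₀` is an FSM-morphism of `F₀`. Thus, by factoring `β₀` as a composite of
> FSMI-morphisms of `F₀` (since we have already shown that `F₀` is of FSMFF-type), we conclude that
> we may write `β = β_b ∘ ⋯ ∘ β₁`, where the `β_j` (for `j = 1, …, b`) are morphisms of `F` that
> project to FSMI-morphisms of `F₀` and to isomorphisms of `D`. Now it follows formally that the `β_j`
> are monomorphisms, hence (again by a formal argument, since `β` is an FSM-morphism) that the `β_j`
> are FSM-morphisms, hence (cf. assertion (v)) FSMI-morphisms. Moreover, by factoring `α_D` as a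
> composite of FSMI-morphisms of `D` (since `D` is, by assumption, of FSMFF-type) and applying
> assertion (vii), we conclude that `α`, `β`, hence also `φ` admits a factorization as a composite
> of FSMI-morphisms of `F`. This completes the proof of assertion (viii)."

Reading notes (ours, not print): the step "factoring `α_D` as a composite of FSMI-morphisms of `D`
… applying assertion (vii)" needs the `D`-factorisation LIFTED to `F` first — that lifting is
item (vi) (plus the model refinement that the lifted factors again project to pull-back morphisms
of `F₀`), which is why hypothesis `hLiftD` below is labelled "(vi) strengthened"; and the author's
*Comments* (Feb. 2019) item (14) inserts the case distinctions "if `β` is not an isomorphism" /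
"FSMI-morphisms/isomorphisms" that the 2008 text leaves implicit — the file implements that
corrected case split (`hβch : IsIso β ∨ ∃ b, IsFSMIChain β b` and `hαch : IsIso α ∨ ∃ r, IsFSMIChain α r`
in `FSMFFTransfer.exists_isFSMIChain_of_isFSM`).

This PROOF-ONLY file (nothing is defined) proves that argument ABSTRACTLY, for functors
`G : F ⥤ D` ("projection to `D`"), `H : F ⥤ F₀` ("projection to `F₀`") and an arbitrary class
`P : MorphismProperty F` standing for "projects to a pull-back morphism of `F₀`", from hypotheses that
are exactly the printed inputs, each of which is either a typed item of Prop. 3.4 (`ArchimedeanFSM.lean`,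
seat abc-iut-L1-t6) or a model lemma about `F = F₀ ×_{D₀} D` to be supplied per tower:

* β-part (`FSMFFTransfer.isFSMIChain_of_map_chain`): an FSM-morphism `β` over an isomorphism of `D`
  whose `F₀`-projection is a composite of `b` FSMI-morphisms is itself a composite of `b`
  FSMI-morphisms — inputs: lifting of `F₀`-factorisations with FSMI first member along arrows over
  isomorphisms of `D` (`hLiftF₀`, model), "over an iso of `D` + mono in `F₀` ⇒ mono" (`hMono`, model),
  "over an iso of `D` + FSM + FSMI in `F₀` ⇒ FSMI" (`hV`, from item (v), second pattern).
* α-part (`FSMFFTransfer.isFSMIChain_of_map_chain'`): an arrow `α ∈ P` whose `D`-projection is a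
  composite of `r` FSMI-morphisms is a composite of `r` FSMI-morphisms — inputs: lifting of
  `D`-factorisations of arrows of `P` to arrows of `P` (`hLiftD`, item (vi) strengthened by the
  model), "`P` + FSMI in `D` ⇒ FSMI" (`hVII`, item (vii)).
* assembly (`FSMFFTransfer.exists_isFSMIChain_of_isFSM`): every non-invertible FSM-morphism `φ` of
  `F` is a composite of FSMI-morphisms — further inputs: the factorisation `φ = β ≫ α` with `β` over
  an iso of `D` and `α ∈ P` (`hFac`, model: pull-back in `F₀` + cartesian factorisation + lift),
  "`P` + mono in `D` ⇒ mono" (`hPMono`), "`P` + iso in `D` ⇒ iso" (`hPIso`, [FrdI] "pull-back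
  morphism and base-isomorphism ⇔ isomorphism"), iso detection (`hIso`), item (iii) (repaired,
  complex regime: `hIII`), the FSM half of item (iv) (`hIV`), condition (a) for `D` (`haD`) and
  condition (a) for `F₀` at arrows between image objects (`ha₀`, sub-node P34-L12).

The instances for a tower `T : ArchFrd.Tower π` with `P φ := IsPullbackMorphism T.str0 (T.toF0.map φ)`
(the hypothesis of the typed item (vii)) are `ArchFrd.Tower.exists_isFSMIChain_of_isFSM` and, combined
with the chain bound of sub-node P34-L13 (`ArchimedeanFSMChainBound.lean`, kept import-free here by
restating only its (b)-conclusion as a hypothesis), `ArchFrd.Tower.isOfFSMFFType2024_of_pieces` /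
`ArchFrd.Tower.isOfFSMFFType_of_pieces` — the conjunct "`F` is of FSMFF-type" of `T.PropVIII`.
The typed item (viii) as a whole is refuted as typed at `π = 𝟭 D₀` (`ArchFrd.not_prop34_viii_id`);
this file takes no position on which towers satisfy its hypotheses. No side is taken on
[IUTchIII] Cor. 3.12.
-/

namespace Literature.AlgebraicGeometry.Frobenioids

open CategoryTheory

universe v₁ v₂ v₃ u₁ u₂ u₃

namespace FSMFFTransfer

section Tools

variable {C : Type u₁} [Category.{v₁} C]

/-- Concatenation of chains of FSMI-morphisms (diagrammatic order): a chain of `m` followed by a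
chain of `k` is a chain of `m + k`. [cite: MochizukiFrdI2008, §0 p.17] -/
theorem chain_append {X Y Z : C} {ψ : X ⟶ Y} {χ : Y ⟶ Z} {m k : ℕ}
    (hψ : IsFSMIChain ψ m) (hχ : IsFSMIChain χ k) : IsFSMIChain (ψ ≫ χ) (m + k) := by
  induction hψ generalizing Z with
  | single ψ h =>
    rw [Nat.add_comm]
    exact IsFSMIChain.cons ψ χ k h hχ
  | cons ψ₁ ψ₂ n h₁ _ ih =>
    rw [Category.assoc, Nat.add_right_comm]
    exact IsFSMIChain.cons ψ₁ (ψ₂ ≫ χ) (n + k) h₁ (ih hχ)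

/-- If `f ≫ g` is fiberwise-surjective then so is `g`. [cite: MochizukiFrdI2008, §0 p.14] -/
theorem isFiberwiseSurjective_of_comp {X Y Z : C} {f : X ⟶ Y} {g : Y ⟶ Z}
    (h : IsFiberwiseSurjective (f ≫ g)) : IsFiberwiseSurjective g := by
  intro W γ
  obtain ⟨D, δ, δ', hδ⟩ := h γ
  exact ⟨D, δ ≫ f, δ', by rw [Category.assoc, hδ]⟩

/-- If `f ≫ g` is an FSM-morphism and `g` is a monomorphism then `g` is an FSM-morphism.
[cite: MochizukiFrdI2008, §0 p.14] -/
theorem isFSM_right_of_comp {X Y Z : C} {f : X ⟶ Y} {g : Y ⟶ Z} (h : IsFSM (f ≫ g)) [Mono g] :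
    IsFSM g :=
  ⟨isFiberwiseSurjective_of_comp h.1, inferInstance⟩

/-- Inversion of a chain of FSMI-morphisms of length `n + 1`: either `n = 0` and the arrow is an
FSMI-morphism, or it is an FSMI-morphism followed by a chain of length `n`.
[cite: MochizukiFrdI2008, §0 p.17] -/
theorem chain_cases {X Z : C} {φ : X ⟶ Z} {n : ℕ} (h : IsFSMIChain φ (n + 1)) :
    (n = 0 ∧ IsFSMI φ) ∨
      ∃ (Y : C) (ψ : X ⟶ Y) (χ : Y ⟶ Z), ψ ≫ χ = φ ∧ IsFSMI ψ ∧ IsFSMIChain χ n := by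
  generalize hm : n + 1 = m at h
  cases h with
  | single φ hφ => exact Or.inl ⟨by omega, hφ⟩
  | cons ψ χ k hψ hχ =>
    obtain rfl : n = k := by omega
    exact Or.inr ⟨_, ψ, χ, rfl, hψ, hχ⟩

/-- There is no chain of FSMI-morphisms of length `0`. [cite: MochizukiFrdI2008, §0 p.17] -/
theorem not_chain_zero {X Z : C} {φ : X ⟶ Z} (h : IsFSMIChain φ 0) : False := by
  have := h.pos
  omega

end Tools

section Transfer

variable {F : Type u₁} [Category.{v₁} F] {D : Type u₂} [Category.{v₂} D]
  {F₀ : Type u₃} [Category.{v₃} F₀] (G : F ⥤ D) (H : F ⥤ F₀)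

/-- **[FrdII] Prop. 3.4 (viii), proof, the `β`-part (p. 33 ll. 22–26), abstract form.** Suppose
that (LiftF₀) along every arrow `β` of `F` over an isomorphism of `D`, a factorisation of `H β` whose
first member is an FSMI-morphism lifts to a factorisation `β = β₁ ≫ β₂` of `F` with `β₁` over an
isomorphism of `D` (up to an isomorphism of the middle object of `F₀`); (Mono) an arrow over an
isomorphism of `D` whose `F₀`-projection is a monomorphism is a monomorphism; (v) an FSM-morphism
over an isomorphism of `D` whose `F₀`-projection is an FSMI-morphism is an FSMI-morphism. Then an
FSM-morphism `β` over an isomorphism of `D` whose `F₀`-projection is a composite of `b`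
FSMI-morphisms is a composite of `b` FSMI-morphisms of `F`. [cite: MochizukiFrdII2008, Prop 3.4 (viii) p.33] -/
theorem isFSMIChain_of_map_chain
    (hLiftF₀ : ∀ {A Z : F} (β : A ⟶ Z), IsIso (G.map β) →
      ∀ {W₀ : F₀} (ε : H.obj A ⟶ W₀) (χ : W₀ ⟶ H.obj Z), ε ≫ χ = H.map β → IsFSMI ε →
        ∃ (W : F) (β₁ : A ⟶ W) (β₂ : W ⟶ Z) (i : H.obj W ≅ W₀),
          β₁ ≫ β₂ = β ∧ IsIso (G.map β₁) ∧ H.map β₁ ≫ i.hom = ε ∧ i.inv ≫ H.map β₂ = χ)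
    (hMono : ∀ {A Z : F} (ψ : A ⟶ Z), IsIso (G.map ψ) → Mono (H.map ψ) → Mono ψ)
    (hV : ∀ {A Z : F} (ψ : A ⟶ Z), IsIso (G.map ψ) → IsFSM ψ → IsFSMI (H.map ψ) → IsFSMI ψ) :
    ∀ (b : ℕ) {A Z : F} (β : A ⟶ Z), IsIso (G.map β) → IsFSM β →
      ∀ {φ₀ : H.obj A ⟶ H.obj Z}, φ₀ = H.map β → IsFSMIChain φ₀ b → IsFSMIChain β b := by
  intro b
  induction b with
  | zero => intro A Z β _ _ φ₀ _ h; exact (not_chain_zero h).elim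
  | succ n ih =>
    intro A Z β hG hβ φ₀ hφ₀ hch
    rcases chain_cases hch with ⟨rfl, hφ⟩ | ⟨W₀, ε, χ, hfac, hε, hχ⟩
    · subst hφ₀
      exact IsFSMIChain.single β (hV β hG hβ hφ)
    · subst hφ₀
      obtain ⟨W, β₁, β₂, i, hcomp, hG₁, h₁, h₂⟩ := hLiftF₀ β hG ε χ hfac hε
      -- `β₂` lies over an isomorphism of `D`
      have hG₂ : IsIso (G.map β₂) := by
        have : G.map β = G.map β₁ ≫ G.map β₂ := by rw [← G.map_comp, hcomp]
        haveI : IsIso (G.map β₁ ≫ G.map β₂) := this ▸ hG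
        exact IsIso.of_isIso_comp_left (G.map β₁) (G.map β₂)
      -- the `F₀`-projections of the two lifted members
      have hH₁ : IsFSMI (H.map β₁) := by
        have : H.map β₁ = ε ≫ i.inv := by rw [← h₁, Category.assoc, i.hom_inv_id, Category.comp_id]
        rw [this]
        exact hε.comp_iso i.symm
      have hH₂ : IsFSMIChain (H.map β₂) n := by
        have : H.map β₂ = i.hom ≫ χ := by rw [← h₂, ← Category.assoc, i.hom_inv_id, Category.id_comp]
        rw [this]
        exact hχ.iso_comp i
      -- `β₂` is a monomorphism, so `β₁` and `β₂` are FSM-morphisms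
      haveI : Mono β₂ := hMono β₂ hG₂ (by haveI := hH₂.isFSM.2; infer_instance)
      have hβ' : IsFSM (β₁ ≫ β₂) := hcomp ▸ hβ
      have hβ₁ : IsFSM β₁ := hβ'.of_comp_mono
      have hβ₂ : IsFSM β₂ := isFSM_right_of_comp hβ'
      rw [← hcomp]
      exact IsFSMIChain.cons β₁ β₂ n (hV β₁ hG₁ hβ₁ hH₁) (ih β₂ hG₂ hβ₂ rfl hH₂)

/-- **[FrdII] Prop. 3.4 (viii), proof, the `α`-part (p. 33 ll. 36–42), abstract form.** Let `P` be a
class of arrows of `F` ("projects to a pull-back morphism of `F₀`") such that (LiftD) factorisations in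
`D` of the projection of an arrow of `P` lift to factorisations in `F` by arrows of `P` (item (vi) with
the model's choice of lifts) and (vii) an arrow of `P` projecting to an FSMI-morphism of `D` is an
FSMI-morphism. Then an arrow of `P` whose `D`-projection is a composite of `r` FSMI-morphisms is a
composite of `r` FSMI-morphisms of `F`. [cite: MochizukiFrdII2008, Prop 3.4 (viii) p.33] -/
theorem isFSMIChain_of_map_chain' (P : MorphismProperty F)
    (hLiftD : ∀ {Z B : F} (α : Z ⟶ B), P α →
      ∀ {E : D} (δ : G.obj Z ⟶ E) (χ : E ⟶ G.obj B), δ ≫ χ = G.map α →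
        ∃ (Z' : F) (α₁ : Z ⟶ Z') (α₂ : Z' ⟶ B) (i : G.obj Z' ≅ E),
          α₁ ≫ α₂ = α ∧ G.map α₁ ≫ i.hom = δ ∧ i.inv ≫ G.map α₂ = χ ∧ P α₁ ∧ P α₂)
    (hVII : ∀ {Z B : F} (α : Z ⟶ B), P α → IsFSMI (G.map α) → IsFSMI α) :
    ∀ (r : ℕ) {Z B : F} (α : Z ⟶ B), P α →
      ∀ {δ₀ : G.obj Z ⟶ G.obj B}, δ₀ = G.map α → IsFSMIChain δ₀ r → IsFSMIChain α r := by
  intro r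
  induction r with
  | zero => intro Z B α _ δ₀ _ h; exact (not_chain_zero h).elim
  | succ n ih =>
    intro Z B α hP δ₀ hδ₀ hch
    rcases chain_cases hch with ⟨rfl, hφ⟩ | ⟨E, δ, χ, hfac, hδ, hχ⟩
    · subst hδ₀
      exact IsFSMIChain.single α (hVII α hP hφ)
    · subst hδ₀
      obtain ⟨Z', α₁, α₂, i, hcomp, h₁, h₂, hP₁, hP₂⟩ := hLiftD α hP δ χ hfac
      have hG₁ : IsFSMI (G.map α₁) := by
        have : G.map α₁ = δ ≫ i.inv := by rw [← h₁, Category.assoc, i.hom_inv_id, Category.comp_id]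
        rw [this]
        exact hδ.comp_iso i.symm
      have hG₂ : IsFSMIChain (G.map α₂) n := by
        have : G.map α₂ = i.hom ≫ χ := by rw [← h₂, ← Category.assoc, i.hom_inv_id, Category.id_comp]
        rw [this]
        exact hχ.iso_comp i
      rw [← hcomp]
      exact IsFSMIChain.cons α₁ α₂ n (hVII α₁ hP₁ hG₁) (ih α₂ hP₂ rfl hG₂)

/-- **[FrdII] Prop. 3.4 (viii), "`F` is of FSMFF-type", condition (a) (p. 33 ll. 16–44), abstract
assembly.** With `G`, `H`, `P` as above, assume: (Fac) every arrow `φ` of `F` factors as `φ = β ≫ α`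
with `β` over an isomorphism of `D` and `α ∈ P`; (PMono) an arrow of `P` over a monomorphism of `D` is
a monomorphism; (PIso) an arrow of `P` over an isomorphism of `D` is an isomorphism; (Iso) an arrow over
isomorphisms of `D` and of `F₀` is an isomorphism; (iii) FSM-morphisms of `F` project to FSM-morphisms
of `D`; (iv) an FSM-morphism over an isomorphism of `D` projects to an FSM-morphism of `F₀`; the
hypotheses of the `β`-part and of the `α`-part; (a) for `D`; and (a) for `F₀` at arrows between objects
in the image of `H`. Then every FSM-morphism of `F` that is not an isomorphism is a composite of
FSMI-morphisms. [cite: MochizukiFrdII2008, Prop 3.4 (viii) p.33] -/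
theorem exists_isFSMIChain_of_isFSM (P : MorphismProperty F)
    (hFac : ∀ {A B : F} (φ : A ⟶ B), ∃ (Z : F) (β : A ⟶ Z) (α : Z ⟶ B),
      β ≫ α = φ ∧ IsIso (G.map β) ∧ P α)
    (hPMono : ∀ {Z B : F} (α : Z ⟶ B), P α → Mono (G.map α) → Mono α)
    (hPIso : ∀ {Z B : F} (α : Z ⟶ B), P α → IsIso (G.map α) → IsIso α)
    (hIso : ∀ {A Z : F} (ψ : A ⟶ Z), IsIso (G.map ψ) → IsIso (H.map ψ) → IsIso ψ)
    (hIII : ∀ {A B : F} (φ : A ⟶ B), IsFSM φ → IsFSM (G.map φ))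
    (hIV : ∀ {A Z : F} (β : A ⟶ Z), IsIso (G.map β) → IsFSM β → IsFSM (H.map β))
    (hLiftF₀ : ∀ {A Z : F} (β : A ⟶ Z), IsIso (G.map β) →
      ∀ {W₀ : F₀} (ε : H.obj A ⟶ W₀) (χ : W₀ ⟶ H.obj Z), ε ≫ χ = H.map β → IsFSMI ε →
        ∃ (W : F) (β₁ : A ⟶ W) (β₂ : W ⟶ Z) (i : H.obj W ≅ W₀),
          β₁ ≫ β₂ = β ∧ IsIso (G.map β₁) ∧ H.map β₁ ≫ i.hom = ε ∧ i.inv ≫ H.map β₂ = χ)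
    (hMono : ∀ {A Z : F} (ψ : A ⟶ Z), IsIso (G.map ψ) → Mono (H.map ψ) → Mono ψ)
    (hV : ∀ {A Z : F} (ψ : A ⟶ Z), IsIso (G.map ψ) → IsFSM ψ → IsFSMI (H.map ψ) → IsFSMI ψ)
    (hLiftD : ∀ {Z B : F} (α : Z ⟶ B), P α →
      ∀ {E : D} (δ : G.obj Z ⟶ E) (χ : E ⟶ G.obj B), δ ≫ χ = G.map α →
        ∃ (Z' : F) (α₁ : Z ⟶ Z') (α₂ : Z' ⟶ B) (i : G.obj Z' ≅ E),
          α₁ ≫ α₂ = α ∧ G.map α₁ ≫ i.hom = δ ∧ i.inv ≫ G.map α₂ = χ ∧ P α₁ ∧ P α₂)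
    (hVII : ∀ {Z B : F} (α : Z ⟶ B), P α → IsFSMI (G.map α) → IsFSMI α)
    (haD : ∀ {X Y : D} (δ : X ⟶ Y), IsFSM δ → ¬ IsIso δ → ∃ n, IsFSMIChain δ n)
    (ha₀ : ∀ {A Z : F} (ψ₀ : H.obj A ⟶ H.obj Z), IsFSM ψ₀ → ¬ IsIso ψ₀ → ∃ n, IsFSMIChain ψ₀ n)
    {A B : F} (φ : A ⟶ B) (hφ : IsFSM φ) (hφiso : ¬ IsIso φ) : ∃ n, IsFSMIChain φ n := by
  obtain ⟨Z, β, α, hcomp, hGβ, hPα⟩ := hFac φ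
  -- `α` projects to an FSM-morphism of `D`, hence is a monomorphism; so `β` is an FSM-morphism
  have hGφ : IsFSM (G.map φ) := hIII φ hφ
  have hGα : IsFSM (G.map α) := by
    have : G.map α = inv (G.map β) ≫ G.map φ := by
      rw [← hcomp, G.map_comp, IsIso.inv_hom_id_assoc]
    rw [this]
    exact (IsFSM.of_isIso _).comp hGφ
  haveI : Mono α := hPMono α hPα hGα.2
  have hβ : IsFSM β := (hcomp ▸ hφ : IsFSM (β ≫ α)).of_comp_mono
  -- the `β`-part: `β` is an isomorphism or a composite of FSMI-morphisms
  have hβch : IsIso β ∨ ∃ b, IsFSMIChain β b := by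
    by_cases hHβ : IsIso (H.map β)
    · exact Or.inl (hIso β hGβ hHβ)
    · obtain ⟨b, hb⟩ := ha₀ (H.map β) (hIV β hGβ hβ) hHβ
      exact Or.inr ⟨b, isFSMIChain_of_map_chain G H hLiftF₀ hMono hV b β hGβ hβ rfl hb⟩
  -- the `α`-part: `α` is an isomorphism or a composite of FSMI-morphisms
  have hαch : IsIso α ∨ ∃ r, IsFSMIChain α r := by
    by_cases hGα' : IsIso (G.map α)
    · exact Or.inl (hPIso α hPα hGα')
    · obtain ⟨r, hr⟩ := haD (G.map α) hGα hGα'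
      exact Or.inr ⟨r, isFSMIChain_of_map_chain' G P hLiftD hVII r α hPα rfl hr⟩
  -- assembly
  rcases hβch with hβi | ⟨b, hb⟩ <;> rcases hαch with hαi | ⟨r, hr⟩
  · exact (hφiso (hcomp ▸ IsIso.comp_isIso)).elim
  · exact ⟨r, hcomp ▸ hr.iso_comp (asIso β)⟩
  · exact ⟨b, hcomp ▸ hb.comp_iso (asIso α)⟩
  · exact ⟨b + r, hcomp ▸ chain_append hb hr⟩

end Transfer

end FSMFFTransfer

/-! ### The tower of Proposition 3.4 -/

namespace ArchFrd

namespace Tower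

universe v u

variable {D : Type u} [Category.{v} D] {π : D ⥤ D0} (T : Tower π)

/-- **[FrdII] Prop. 3.4 (viii), condition (a) for a tower `F ∈ {A, N, R}`**, with
`P φ := "T.toF0.map φ is a pull-back morphism of F₀"` (the hypothesis of the typed item (vii)): every
non-invertible FSM-morphism of `F` is a composite of FSMI-morphisms, GIVEN — by name — the typed items
(iii) (`T.PropIII`, e.g. in the complex regime `prop34_iii_of_isComplex`), (iv) (`T.PropIV`) with
"`D` complexifiable", the second pattern of (v) packaged with FSM (`hV`), (vii) (`T.PropVII`), and the
model lemmas (Fac), (PMono), (PIso), (Iso), (LiftF₀), (Mono), (LiftD) of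
`FSMFFTransfer.exists_isFSMIChain_of_isFSM`, condition (a) for `D` and condition (a) for `F₀` at
arrows between image objects. [cite: MochizukiFrdII2008, Prop 3.4 (viii) p.33] -/
theorem exists_isFSMIChain_of_isFSM (hIII : T.PropIII) (hIV : T.PropIV)
    (hc : RC.IsComplexifiable (π ⋙ D0.toArchBase)) (hVIIt : T.PropVII)
    (hFac : ∀ {A B : T.F} (φ : A ⟶ B), ∃ (Z : T.F) (β : A ⟶ Z) (α : Z ⟶ B),
      β ≫ α = φ ∧ IsIso (T.toD.map β) ∧ PreFrobenioid.IsPullbackMorphism T.str0 (T.toF0.map α))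
    (hPMono : ∀ {Z B : T.F} (α : Z ⟶ B), PreFrobenioid.IsPullbackMorphism T.str0 (T.toF0.map α) →
      Mono (T.toD.map α) → Mono α)
    (hPIso : ∀ {Z B : T.F} (α : Z ⟶ B), PreFrobenioid.IsPullbackMorphism T.str0 (T.toF0.map α) →
      IsIso (T.toD.map α) → IsIso α)
    (hIso : ∀ {A Z : T.F} (ψ : A ⟶ Z), IsIso (T.toD.map ψ) → IsIso (T.toF0.map ψ) → IsIso ψ)
    (hLiftF₀ : ∀ {A Z : T.F} (β : A ⟶ Z), IsIso (T.toD.map β) →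
      ∀ {W₀ : T.F0} (ε : T.toF0.obj A ⟶ W₀) (χ : W₀ ⟶ T.toF0.obj Z), ε ≫ χ = T.toF0.map β →
        IsFSMI ε → ∃ (W : T.F) (β₁ : A ⟶ W) (β₂ : W ⟶ Z) (i : T.toF0.obj W ≅ W₀),
          β₁ ≫ β₂ = β ∧ IsIso (T.toD.map β₁) ∧ T.toF0.map β₁ ≫ i.hom = ε ∧
            i.inv ≫ T.toF0.map β₂ = χ)
    (hMono : ∀ {A Z : T.F} (ψ : A ⟶ Z), IsIso (T.toD.map ψ) → Mono (T.toF0.map ψ) → Mono ψ)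
    (hV : ∀ {A Z : T.F} (ψ : A ⟶ Z), IsIso (T.toD.map ψ) → IsFSM ψ → IsFSMI (T.toF0.map ψ) →
      IsFSMI ψ)
    (hLiftD : ∀ {Z B : T.F} (α : Z ⟶ B), PreFrobenioid.IsPullbackMorphism T.str0 (T.toF0.map α) →
      ∀ {E : D} (δ : T.toD.obj Z ⟶ E) (χ : E ⟶ T.toD.obj B), δ ≫ χ = T.toD.map α →
        ∃ (Z' : T.F) (α₁ : Z ⟶ Z') (α₂ : Z' ⟶ B) (i : T.toD.obj Z' ≅ E),
          α₁ ≫ α₂ = α ∧ T.toD.map α₁ ≫ i.hom = δ ∧ i.inv ≫ T.toD.map α₂ = χ ∧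
            PreFrobenioid.IsPullbackMorphism T.str0 (T.toF0.map α₁) ∧
            PreFrobenioid.IsPullbackMorphism T.str0 (T.toF0.map α₂))
    (haD : ∀ {X Y : D} (δ : X ⟶ Y), IsFSM δ → ¬ IsIso δ → ∃ n, IsFSMIChain δ n)
    (ha₀ : ∀ {A Z : T.F} (ψ₀ : T.toF0.obj A ⟶ T.toF0.obj Z), IsFSM ψ₀ → ¬ IsIso ψ₀ →
      ∃ n, IsFSMIChain ψ₀ n)
    {A B : T.F} (φ : A ⟶ B) (hφ : IsFSM φ) (hφiso : ¬ IsIso φ) : ∃ n, IsFSMIChain φ n :=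
  FSMFFTransfer.exists_isFSMIChain_of_isFSM T.toD T.toF0
    (fun {_ _} φ => PreFrobenioid.IsPullbackMorphism T.str0 (T.toF0.map φ))
    hFac hPMono hPIso hIso (fun φ hφ => hIII φ hφ) (fun β hG hβ => (hIV hc β hG).1 hβ)
    hLiftF₀ hMono hV hLiftD (fun α hP hG => (hVIIt α hP).2 hG) haD ha₀ φ hφ hφiso

/-- **[FrdII] Prop. 3.4 (viii), "`F` is of FSMFF-type" (revised notion) assembled from the two
sub-nodes**: condition (a) (this file, all its inputs by name) and condition (b) (sub-node P34-L13,
`ArchFrd.Tower.exists_headedChain_bound` of `ArchimedeanFSMChainBound.lean`, entering here as the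
hypothesis `hb`). [cite: MochizukiFrdII2008, Prop 3.4 (viii) p.33] -/
theorem isOfFSMFFType2024_of_pieces
    (ha : ∀ {A B : T.F} (φ : A ⟶ B), IsFSM φ → ¬ IsIso φ → ∃ n, IsFSMIChain φ n)
    (hb : ∀ A : T.F, ∃ N : ℕ, ∀ {B : T.F} (φ : A ⟶ B) (n : ℕ), IsHeadedFSMIChain ⊤ φ n → n ≤ N) :
    IsOfFSMFFType2024 T.F :=
  ⟨ha, hb⟩

/-- **[FrdII] Prop. 3.4 (viii), the conjunct "`F` is of FSMFF-type" of the typed item `T.PropVIII`**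
(2008 notion) from the two sub-nodes (a) and (b). [cite: MochizukiFrdII2008, Prop 3.4 (viii) p.30] -/
theorem isOfFSMFFType_of_pieces
    (ha : ∀ {A B : T.F} (φ : A ⟶ B), IsFSM φ → ¬ IsIso φ → ∃ n, IsFSMIChain φ n)
    (hb : ∀ A : T.F, ∃ N : ℕ, ∀ {B : T.F} (φ : A ⟶ B) (n : ℕ), IsHeadedFSMIChain ⊤ φ n → n ≤ N) :
    IsOfFSMFFType T.F :=
  (T.isOfFSMFFType2024_of_pieces ha hb).isOfFSMFFType

end Tower

end ArchFrd

end Literature.AlgebraicGeometry.Frobenioids
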